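import Mathlib
import Summits.ResolutionOfSingularities.ResolutionOfSingularities.Theorems.RadicialJungCleanModelsCleanProp44OfCurveSlice
import HarnessLib

/-!
# Route `RadicialJung`, crux `CleanModels` (stmt-ResolutionOfSingularities-15917), line `Sketch` rev 35, stub 6 `stub_cleanProp44` (X44c):
# TENTH CUT — X44c ⟸ (R1) ∧ (R3ᵛⁿ′): the kernel census of stub 6 reduced to clean Phase II and the very-near curve slice

Seat decomp-res-hand-2 g16 (structural hand), sequel of ✓ `…CleanProp44OfCurveSlice.lean` (ninth cut X44c ⟸ (R1) ∧ (R3); (R2) ⟸ (R3)) and of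
g15's sixth cut ✓ `cleanProp44_of_tauOneResidualVN3 : (R1) → (R2ᵛⁿ′) → (R3ᵛⁿ′) → X44c`.

* `curveSlice_of_curveSliceVN` — (R3) ⟸ (R3ᵛⁿ′) pointwise (the case split of ✓ `cleanProp44_of_tauOneResidualVN2` as an implication of schemas:
  curves clean-permissible everywhere without very near points are settled by ✓ `exists_isCleanPermissibleSeq_lt_comap_of_curve_of_cleanPermissible_of_forall_near_two_le`).
* `cleanProp44_of_phaseTwo_of_curveTauOneVN` — **TENTH CUT: X44c ⟸ (R1) ∧ (R3ᵛⁿ′)** (hypotheses `hphaseTwo`, `hcurveTauOneVN` of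
  ✓ `cleanProp44_of_tauOneResidualVN3` verbatim).

NET for the planner (repair census of stub 6, by name): X44c ⟸ (R1) clean Phase II of reach-tidy — acts only at `τ = 1` points lying on two
`Σ`-curves [L–XL] — ∧ (R3ᵛⁿ′) the clean curve slice through a `τ = 1` point for curves needing an L7b insertion or carrying a very near point
[XL: births, memo 4e §2.4–2.6].  The isolated-point slice (R2) and all chains of very near points are ABSORBED (T1 ✓).  RE-LINE proposal:
`stub_cleanProp44 := cleanProp44_of_phaseTwo_of_curveTauOneVN stub_cleanPhaseTwo stub_cleanCurveTauOneVN`.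

Honest framing: OURS; (R1) and (R3ᵛⁿ′) are NOT proved here; nothing here proves X44c, any case of `CleanModels`, or resolution of singularities in
characteristic `p`. [cite: CossartPiltant2008, Prop. 4.2 (b), Lemma 4.3, Prop. 4.4, Lemma 4.5] [cite: CossartJannsenSaito2020, Thm. 13.7]
[cite: Piltant2013, Prop. 5.1 (proof, Step 2)]
-/

noncomputable section

set_option linter.dupNamespace false -- mandated namespace of this single-conjunct summit

open CategoryTheory CategoryTheory.Limits AlgebraicGeometry TopologicalSpace IsLocalRing
open Literature.AlgebraicGeometry.Resolution Literature.AlgebraicGeometry.Motives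
open Scheme.IdealSheafData
open Summit.ResolutionOfSingularities.ResolutionOfSingularities.Theorems.CP2008Prop44

namespace Summit.ResolutionOfSingularities.ResolutionOfSingularities.Theorems.RadicialJung.CleanModels

/-! ## §1 The plain curve slice (R3) from its very-near form (R3ᵛⁿ′) -/

set_option maxHeartbeats 800000 in
-- long binder lists
/-- **(R3) ⟸ (R3ᵛⁿ′), pointwise** (for fixed `p` and `m`): a curve which is clean-permissible at every point AND has no very near point over it is
settled by ✓ `exists_isCleanPermissibleSeq_lt_comap_of_curve_of_cleanPermissible_of_forall_near_two_le` (the `X`-relative very-near condition made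
`V`-relative by ✓ `forall_near_two_le_preimage_of_forall_near_two_le`); every other curve is what (R3ᵛⁿ′) is asked for.  (The case split of
✓ `cleanProp44_of_tauOneResidualVN2`, restated as an implication between the two hypothesis schemas.) [cite: CossartPiltant2008, Prop. 4.2 (b), Lemma 4.5] -/
theorem curveSlice_of_curveSliceVN {p : ℕ} (hp : p.Prime) {m : ℕ} (hm : 1 ≤ m)
    (hcurveVN : ∀ {X : Scheme.{0}} [IsIntegral X] [IsNoetherian X], CharP X.functionField p →
      ∀ (hX : Scheme.IsRegular X), Scheme.IsQuasiExcellent X → topologicalKrullDim X ≤ 3 →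
      ∀ (G : X.functionField), (∀ x : X, CleanRegAt p (algebraMap (X.presheaf.stalk x) X.functionField) G) →
      ∀ (J : X.IdealSheafData), (∀ z, idealOrder J z ≤ m) → (∀ z ∈ J.support, 1 < Order.coheight z) →
      ∀ (V : X.Opens) (Y : Closeds X), Scheme.IsRegular (vanishingIdeal Y).subscheme → IsIrreducible (Y : Set X) →
      (Y : Set X) ⊆ (V : Set X) → (∀ z : X, (m : ℕ∞) ≤ idealOrder J z → z ∈ (Y : Set X) ∨ z ∉ (V : Set X)) →
      (∀ y ∈ (Y : Set X), idealOrder J y = m) →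
      (∀ y ∈ (Y : Set X), haveI := hX y; ∃ c : Fin 2 → X.presheaf.stalk y, IsRsopPart c ∧
        Ideal.span (Set.range c) = stalkIdeal (vanishingIdeal Y) y) →
      (¬ ∀ y ∈ (Y : Set X), IsClosed ({y} : Set X) → haveI := hX y; 2 ≤ stalkTau J y m) →
      (¬ ((∀ y ∈ (Y : Set X), CleanPermissibleAt p (algebraMap (X.presheaf.stalk y) X.functionField) G (stalkIdeal (vanishingIdeal Y) y)) ∧
          (∀ (X₁ : Scheme.{0}) (π : X₁ ⟶ X), IsBlowup π (vanishingIdeal Y) →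
            ∀ x' : X₁, IsClosed ({x'} : Set X₁) → π x' ∈ (Y : Set X) →
              idealOrder (controlledTransform π (vanishingIdeal Y) J m) x' = m →
              (maximalIdeal (X₁.presheaf.stalk x')).spanFinrank = 3 →
              ∀ hr : IsRegularLocalRing (X₁.presheaf.stalk x'), 2 ≤ @stalkTau X₁ (controlledTransform π (vanishingIdeal Y) J m) x' hr m))) →
      ∀ [IsIntegral ((V : X.Opens) : Scheme.{0})] [IsDominant V.ι],
      ∃ (V' : Scheme.{0}) (π : V' ⟶ V) (_ : IsIntegral V') (_ : IsDominant π) (K' : V'.IdealSheafData),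
        IsCleanPermissibleSeq p π (J.comap V.ι) m K' (RatFn.functionFieldMap V.ι G) ∧ ∀ y, idealOrder K' y < m) :
    ∀ {X : Scheme.{0}} [IsIntegral X] [IsNoetherian X], CharP X.functionField p →
      ∀ (hX : Scheme.IsRegular X), Scheme.IsQuasiExcellent X → topologicalKrullDim X ≤ 3 →
      ∀ (G : X.functionField), (∀ x : X, CleanRegAt p (algebraMap (X.presheaf.stalk x) X.functionField) G) →
      ∀ (J : X.IdealSheafData), (∀ z, idealOrder J z ≤ m) → (∀ z ∈ J.support, 1 < Order.coheight z) →
      ∀ (V : X.Opens) (Y : Closeds X), Scheme.IsRegular (vanishingIdeal Y).subscheme → IsIrreducible (Y : Set X) →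
      (Y : Set X) ⊆ (V : Set X) → (∀ z : X, (m : ℕ∞) ≤ idealOrder J z → z ∈ (Y : Set X) ∨ z ∉ (V : Set X)) →
      (∀ y ∈ (Y : Set X), idealOrder J y = m) →
      (∀ y ∈ (Y : Set X), haveI := hX y; ∃ c : Fin 2 → X.presheaf.stalk y, IsRsopPart c ∧
        Ideal.span (Set.range c) = stalkIdeal (vanishingIdeal Y) y) →
      (¬ ∀ y ∈ (Y : Set X), IsClosed ({y} : Set X) → haveI := hX y; 2 ≤ stalkTau J y m) →
      ∀ [IsIntegral ((V : X.Opens) : Scheme.{0})] [IsDominant V.ι],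
      ∃ (V' : Scheme.{0}) (π : V' ⟶ V) (_ : IsIntegral V') (_ : IsDominant π) (K' : V'.IdealSheafData),
        IsCleanPermissibleSeq p π (J.comap V.ι) m K' (RatFn.functionFieldMap V.ι G) ∧ ∀ y, idealOrder K' y < m := by
  intro X _ _ hchar hX hqe hX3 G hG J hle hcodim V Y hYreg hirr hYV hJY hordY hrsop hτ _ _
  by_cases H : (∀ y ∈ (Y : Set X), CleanPermissibleAt p (algebraMap (X.presheaf.stalk y) X.functionField) G (stalkIdeal (vanishingIdeal Y) y)) ∧
      (∀ (X₁ : Scheme.{0}) (π : X₁ ⟶ X), IsBlowup π (vanishingIdeal Y) →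
        ∀ x' : X₁, IsClosed ({x'} : Set X₁) → π x' ∈ (Y : Set X) →
          idealOrder (controlledTransform π (vanishingIdeal Y) J m) x' = m →
          (maximalIdeal (X₁.presheaf.stalk x')).spanFinrank = 3 →
          ∀ hr : IsRegularLocalRing (X₁.presheaf.stalk x'), 2 ≤ @stalkTau X₁ (controlledTransform π (vanishingIdeal Y) J m) x' hr m)
  · haveI := hchar
    exact exists_isCleanPermissibleSeq_lt_comap_of_curve_of_cleanPermissible_of_forall_near_two_le hp hX hqe hX3 G hG J hm hle hcodim V Y
      hYreg hirr hYV hJY hordY H.1 (forall_near_two_le_preimage_of_forall_near_two_le hX3 J m V Y H.2)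
  · exact hcurveVN hchar hX hqe hX3 G hG J hle hcodim V Y hYreg hirr hYV hJY hordY hrsop hτ H

/-! ## §2 TENTH CUT: X44c ⟸ (R1) ∧ (R3ᵛⁿ′) -/

set_option maxHeartbeats 1600000 in
-- long binder lists
/-- **THE CLEAN ASSEMBLY, TENTH CUT: X44c (`stub_cleanProp44`, verbatim) ⟸ (R1) clean Phase II of reach-tidy ∧ (R3ᵛⁿ′) the clean curve slice for
curves through a `τ = 1` point that need an insertion or carry a very near point** — the hypotheses `hphaseTwo` and `hcurveTauOneVN` of
✓ `cleanProp44_of_tauOneResidualVN3` VERBATIM, its middle hypothesis (R2ᵛⁿ′) being DERIVED: (R2) ⟸ (R3) by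
✓ `exists_isCleanPermissibleSeq_lt_comap_of_isolated_tauOne_of_curveSlice`, (R3) ⟸ (R3ᵛⁿ′) by `curveSlice_of_curveSliceVN`.
[cite: CossartPiltant2008, Prop. 4.2 (b), Prop. 4.4, Lemma 4.5] [cite: CossartJannsenSaito2020, Thm. 13.7] [cite: Piltant2013, Prop. 5.1 (proof, Step 2)] -/
theorem cleanProp44_of_phaseTwo_of_curveTauOneVN
    (hphaseTwo : ∀ (p : ℕ), p.Prime → ∀ {X : Scheme.{0}} [IsIntegral X] [IsNoetherian X], CharP X.functionField p →
      ∀ (hX : Scheme.IsRegular X), Scheme.IsQuasiExcellent X → topologicalKrullDim X ≤ 3 →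
      ∀ (G : X.functionField), (∀ x : X, CleanRegAt p (algebraMap (X.presheaf.stalk x) X.functionField) G) →
      ∀ (J : X.IdealSheafData) {μ : ℕ}, 1 ≤ μ → (∀ z, idealOrder J z ≤ μ) → (∀ z ∈ J.support, 1 < Order.coheight z) →
      (∀ x : X, ¬ ∃ C ∈ {C : Closeds X | ∃ ζ ∈ maxPoints {z : X | (μ : ℕ∞) ≤ idealOrder J z},
          ¬ IsClosed ({ζ} : Set X) ∧ C = ⟨closure {ζ}, isClosed_closure⟩},
        x ∈ (vanishingIdeal C).subschemeι '' (Scheme.regularLocus (vanishingIdeal C).subscheme)ᶜ ∨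
        (x ∈ (C : Set X) ∧ ∃ C' ∈ {C : Closeds X | ∃ ζ ∈ maxPoints {z : X | (μ : ℕ∞) ≤ idealOrder J z},
            ¬ IsClosed ({ζ} : Set X) ∧ C = ⟨closure {ζ}, isClosed_closure⟩}, C' ≠ C ∧ x ∈ (C' : Set X) ∧
          stalkIdeal (vanishingIdeal C) x ⊔ stalkIdeal (vanishingIdeal C') x ≠ maximalIdeal (X.presheaf.stalk x))) →
      ∃ (X₁ : Scheme.{0}) (Φ : X₁ ⟶ X) (_ : IsIntegral X₁) (_ : IsDominant Φ) (J₁ : X₁.IdealSheafData)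
        (_ : IsCleanPermissibleSeq p Φ J μ J₁ G),
        (∀ ζ : X₁, (μ : ℕ∞) ≤ idealOrder J₁ ζ → Order.coheight ζ = 2 → ¬ IsClosed ({ζ} : Set X₁) →
            Scheme.IsRegular (vanishingIdeal (⟨closure {ζ}, isClosed_closure⟩ : Closeds X₁)).subscheme) ∧
        (∀ ζ₁ ζ₂ : X₁, (μ : ℕ∞) ≤ idealOrder J₁ ζ₁ → Order.coheight ζ₁ = 2 → ¬ IsClosed ({ζ₁} : Set X₁) →
            (μ : ℕ∞) ≤ idealOrder J₁ ζ₂ → Order.coheight ζ₂ = 2 → ¬ IsClosed ({ζ₂} : Set X₁) → ζ₁ ≠ ζ₂ →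
            Disjoint (closure ({ζ₁} : Set X₁)) (closure {ζ₂})))
    (hcurveTauOneVN : ∀ (p : ℕ), p.Prime → ∀ {X : Scheme.{0}} [IsIntegral X] [IsNoetherian X], CharP X.functionField p →
      ∀ (hX : Scheme.IsRegular X), Scheme.IsQuasiExcellent X → topologicalKrullDim X ≤ 3 →
      ∀ (G : X.functionField), (∀ x : X, CleanRegAt p (algebraMap (X.presheaf.stalk x) X.functionField) G) →
      ∀ (J : X.IdealSheafData) {m : ℕ}, 1 ≤ m → (∀ z, idealOrder J z ≤ m) → (∀ z ∈ J.support, 1 < Order.coheight z) →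
      ∀ (V : X.Opens) (Y : Closeds X), Scheme.IsRegular (vanishingIdeal Y).subscheme → IsIrreducible (Y : Set X) →
      (Y : Set X) ⊆ (V : Set X) → (∀ z : X, (m : ℕ∞) ≤ idealOrder J z → z ∈ (Y : Set X) ∨ z ∉ (V : Set X)) →
      (∀ y ∈ (Y : Set X), idealOrder J y = m) →
      (∀ y ∈ (Y : Set X), haveI := hX y; ∃ c : Fin 2 → X.presheaf.stalk y, IsRsopPart c ∧
        Ideal.span (Set.range c) = stalkIdeal (vanishingIdeal Y) y) →
      (¬ ∀ y ∈ (Y : Set X), IsClosed ({y} : Set X) → haveI := hX y; 2 ≤ stalkTau J y m) →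
      -- (VN′) NOT (clean-permissible at every point of `Y` AND no very near point over `Y` for the blowing ups of `X` along `Y`)
      (¬ ((∀ y ∈ (Y : Set X), CleanPermissibleAt p (algebraMap (X.presheaf.stalk y) X.functionField) G (stalkIdeal (vanishingIdeal Y) y)) ∧
          (∀ (X₁ : Scheme.{0}) (π : X₁ ⟶ X), IsBlowup π (vanishingIdeal Y) →
            ∀ x' : X₁, IsClosed ({x'} : Set X₁) → π x' ∈ (Y : Set X) →
              idealOrder (controlledTransform π (vanishingIdeal Y) J m) x' = m →
              (maximalIdeal (X₁.presheaf.stalk x')).spanFinrank = 3 →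
              ∀ hr : IsRegularLocalRing (X₁.presheaf.stalk x'), 2 ≤ @stalkTau X₁ (controlledTransform π (vanishingIdeal Y) J m) x' hr m))) →
      ∀ [IsIntegral ((V : X.Opens) : Scheme.{0})] [IsDominant V.ι],
      ∃ (V' : Scheme.{0}) (π : V' ⟶ V) (_ : IsIntegral V') (_ : IsDominant π) (K' : V'.IdealSheafData),
        IsCleanPermissibleSeq p π (J.comap V.ι) m K' (RatFn.functionFieldMap V.ι G) ∧ ∀ y, idealOrder K' y < m) :
    ∀ (p : ℕ), p.Prime → ∀ (S : Scheme.{0}) [IsIntegral S] [IsNoetherian S],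
      CharP S.functionField p → Scheme.IsRegular S → Scheme.IsExcellent S → topologicalKrullDim S = 3 →
      ∀ G₀ : S.functionField, (∀ s : S, CleanRegAt p (algebraMap (S.presheaf.stalk s) S.functionField) G₀) →
      ∀ I : S.IdealSheafData, I ≠ ⊥ →
      ∀ (X : Scheme.{0}) (ρ : X ⟶ S) [IsIntegral X] [IsNoetherian X] [IsDominant ρ],
        IsCleanRegularCentreBlowupSeq p ρ I G₀ →
        (∀ x : X, CleanRegAt p (algebraMap (X.presheaf.stalk x) X.functionField) (RatFn.functionFieldMap ρ G₀)) →
        ∀ (J : X.IdealSheafData) (μ : ℕ), 1 ≤ μ →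
          (∀ x ∈ J.support, 1 < Order.coheight x) → (∀ x, idealOrder J x ≤ μ) → (∃ x, idealOrder J x = μ) →
          ∃ (X' : Scheme.{0}) (π : X' ⟶ X) (_ : IsIntegral X') (_ : IsDominant π) (J' : X'.IdealSheafData),
            IsCleanPermissibleSeq p π J μ J' (RatFn.functionFieldMap ρ G₀) ∧ ∀ x, idealOrder J' x < μ := by
  refine cleanProp44_of_tauOneResidualVN3 hphaseTwo ?_ hcurveTauOneVN
  intro p hp X _ _ hchar hX hqe hX3 G hG J m hm hle hcodim V x hxV hcl hbad hord hdim hτ hGr _ _ _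
  haveI := hchar
  exact exists_isCleanPermissibleSeq_lt_comap_of_isolated_tauOne_of_curveSlice hp hm
    (curveSlice_of_curveSliceVN hp hm
      (fun hch hY hYqe hY3 GY hGY JY hleY hcodY W C hCreg hCirr hCW hJC hordC hrsop hτ2 hvn =>
        hcurveTauOneVN p hp hch hY hYqe hY3 GY hGY JY hm hleY hcodY W C hCreg hCirr hCW hJC hordC hrsop hτ2 hvn))
    hX hqe hX3 G hG J hle hcodim V x hxV hcl hbad hord hdim hτ hGr

end Summit.ResolutionOfSingularities.ResolutionOfSingularities.Theorems.RadicialJung.CleanModels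

end
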